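import Summits.CriticalPhenomena.CardyFormulaZ2.Theorems.CardyComplexConeSLESixFamiliesGiveCardyLowerRunPart1
import Literature.Probability.Percolation.InterfaceTraversalBound
import Literature.Probability.Percolation.BoxCrossingUpperBound
import HarnessLib

/-!
# Stub `upperFence` of line `collar-touch-sandwich` — Part 2: mesh-side eventualities

Crux `SLESixFamiliesGiveCardy` (stmt-CriticalPhenomena-9654), route `CardyComplexCone`.  Second
helper file of STUB A `stub_upperFence : UpperFence`.  Lattice/metric inputs of the fence
argument, each "eventually in the mesh" or deterministic at one mesh:

* `eventually_meshDomain_subset_of_subset` (`Ω ⊆ Ω'` ⇒ `Ω_δ ⊆ Ω'_δ` and `Ω_δ ≤ Ω'_δ` as graphs,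
  for all small `δ`, Jordan domains; largest-component convention, so only eventually — bulk
  theorem at a common ball), `UpperCollarGeom.eventually_discreteDomainGraph_le`,
  `UpperCollarGeom.eventually_edge_mem`;
* `isInnerFace_iff_of_eq`, `pertTrace_subset_carrier_of_eq` — the perturbed exploration polygon
  (`IsMedialExploration.pertTrace`, `ExplorationPolygon.lean`) of ANY Dobrushin data on
  `(D.carrier, δ)` lies in `D.carrier` (transfer of `pertTrace_subset_carrier` from the canonical
  data to a family member);
* `upperFence_dual_near_touch(')` — under `UpperCollarGeom`, eventually every dual-wired site
  (`zdArcB`) whose mesh point lies in `closure Ω` is within `η/2` of the touch set `G`;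
* `connector_not_adj_of_far`, `UpperCollarGeom.eventually_connector_not_adj`,
  `exists_frontier_exit_not_adj` — the exit connectors of the open crossing are NOT `D_δ`-edges,
  and a first frontier exit keeping the non-adjacency.

Provenance: written and machine-checked by the crux's `drefute` refuters (gens 3 and 6:
`MeshDomainMonotoneG6.lean`, `PertTraceSubsetCarrierG6.lean`, `UpperFenceDualNearTouch.lean`,
`ConnectorExclusionG6.lean` of the crux directory); vendored by the lead up to names/namespaces.
-/

noncomputable section

open Set Filter Topology Metric
open scoped NNReal Pointwise
open Literature.Probability Literature.Probability.RandomPlanarGeometry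
  Literature.Probability.LatticeModels Literature.Probability.Percolation
open Literature.Probability.LatticeModels.IsMedialExploration

namespace Summit.CriticalPhenomena.CardyFormulaZ2.Cruxes.SLESixFamiliesGiveCardy.CollarTouchSandwich

/-! ### Eventual monotonicity of the discrete domain -/

/-- Reachability in the mesh vertex graph is monotone in the domain. [folklore] -/
theorem reachable_meshVertexGraph_mono {Ω Ω' : Set ℂ} (h : Ω ⊆ Ω') {δ : ℝ}
    {x y : meshVertices Ω δ} (hxy : (meshVertexGraph Ω δ).Reachable x y) :
    (meshVertexGraph Ω' δ).Reachable
      (⟨x.1, h x.2⟩ : meshVertices Ω' δ) ⟨y.1, h y.2⟩ := by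
  let φ : meshVertexGraph Ω δ →g meshVertexGraph Ω' δ :=
    { toFun := fun v => ⟨v.1, h v.2⟩
      map_rel' := fun {a b} hab => by
        show (meshGraph Ω' δ).Adj a.1 b.1
        exact meshGraph_adj_iff.2 ⟨(meshGraph_adj_iff.1 hab).1,
          (meshGraph_adj_iff.1 hab).2.trans (closure_mono h)⟩ }
  exact hxy.map φ

/-- **Eventual monotonicity of the largest-component discretisation (Jordan domains).**  If
`D.carrier ⊆ D'.carrier` then for all small meshes `δ > 0` the discrete domain of `D` lies in
that of `D'` and the graph `Ω_δ` is a subgraph of `Ω'_δ`. [folklore] -/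
theorem eventually_meshDomain_subset_of_subset
    (D D' : JordanDomain) (h : D.carrier ⊆ D'.carrier) :
    ∀ᶠ δ : ℝ in 𝓝[>] 0, meshDomain D.carrier δ ⊆ meshDomain D'.carrier δ ∧
      discreteDomainGraph D.carrier δ ≤ discreteDomainGraph D'.carrier δ := by
  -- a closed ball inside the smaller domain
  obtain ⟨z₀, hz₀⟩ := D.nonempty
  obtain ⟨ρ, hρ, hball⟩ := Metric.isOpen_iff.1 D.isOpen z₀ hz₀
  have hK : IsCompact (closedBall z₀ (ρ / 2)) := isCompact_closedBall _ _
  have hKΩ : closedBall z₀ (ρ / 2) ⊆ D.carrier :=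
    (closedBall_subset_ball (by linarith)).trans hball
  obtain ⟨δ₁, hδ₁, H₁⟩ := D.exists_forall_mem_meshDomain_and_reachable hK hKΩ
  obtain ⟨δ₂, hδ₂, H₂⟩ := D'.exists_forall_mem_meshDomain_and_reachable hK (hKΩ.trans h)
  have hm : 0 < min (min δ₁ δ₂) (ρ / 2) := lt_min (lt_min hδ₁ hδ₂) (by linarith)
  filter_upwards [Ioo_mem_nhdsGT hm] with δ hδ
  have hδ0 : 0 < δ := hδ.1
  have hδ1 : δ < δ₁ := hδ.2.trans_le ((min_le_left _ _).trans (min_le_left _ _))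
  have hδ2 : δ < δ₂ := hδ.2.trans_le ((min_le_left _ _).trans (min_le_right _ _))
  have hδρ : δ < ρ / 2 := hδ.2.trans_le (min_le_right _ _)
  -- a common site of both discrete domains
  set x₀ : Site 2 := nearestSite δ z₀ with hx₀
  have hx₀K : meshPoint δ x₀ ∈ closedBall z₀ (ρ / 2) := by
    rw [mem_closedBall]
    exact (dist_meshPoint_nearestSite_le hδ0 z₀).trans hδρ.le
  have hx₀D : x₀ ∈ meshDomain D.carrier δ := (H₁ δ hδ0 hδ1).1 x₀ hx₀K
  have hx₀D' : x₀ ∈ meshDomain D'.carrier δ := (H₂ δ hδ0 hδ2).1 x₀ hx₀K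
  -- vertices
  have hsub : meshDomain D.carrier δ ⊆ meshDomain D'.carrier δ := by
    intro x hx
    obtain ⟨hx₀v, hxv, hreach⟩ := (H₁ δ hδ0 hδ1).2 x₀ hx₀D x hx
    have hreach' := reachable_meshVertexGraph_mono h (x := ⟨x₀, hx₀v⟩) (y := ⟨x, hxv⟩) hreach
    exact mem_meshDomain_of_reachable_meshVertexGraph hx₀D' (h hx₀v) (h hxv) hreach'
  refine ⟨hsub, fun x y hxy => ?_⟩
  -- edges
  rw [discreteDomainGraph_adj_iff] at hxy ⊢
  exact ⟨meshGraph_adj_iff.2 ⟨(meshGraph_adj_iff.1 hxy.1).1,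
    (meshGraph_adj_iff.1 hxy.1).2.trans (closure_mono h)⟩, hsub hxy.2.1, hsub hxy.2.2⟩

/-- The form consumed by STUB A: under `UpperCollarGeom R D G`, for all small meshes the free
crossing's graph `Ω_δ` (of the rectangle `R`) is a subgraph of the collared domain's `D_δ`, and
`Ω_δ ⊆ D_δ`. [folklore] -/
theorem UpperCollarGeom.eventually_discreteDomainGraph_le {R : ConformalRectangle}
    {D : DobrushinDomain} {G : Set ℂ} (hg : UpperCollarGeom R D G) :
    ∀ᶠ δ : ℝ in 𝓝[>] 0, meshDomain R.carrier δ ⊆ meshDomain D.carrier δ ∧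
      discreteDomainGraph R.carrier δ ≤ discreteDomainGraph D.carrier δ :=
  eventually_meshDomain_subset_of_subset R.toJordanDomain D.toJordanDomain hg.carrier_subset

/-- Consequence used verbatim in the fence argument: eventually, an edge of the open crossing
graph `openGraph ω ⊓ Ω_δ` of the rectangle is an edge of the collared discrete domain `D_δ`.
[folklore] -/
theorem UpperCollarGeom.eventually_edge_mem {R : ConformalRectangle}
    {D : DobrushinDomain} {G : Set ℂ} (hg : UpperCollarGeom R D G) :
    ∀ᶠ δ : ℝ in 𝓝[>] 0, ∀ (ω : Percolation.BondConfig (Site 2)) (x y : Site 2),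
      (Percolation.openGraph ω ⊓ discreteDomainGraph R.carrier δ).Adj x y →
        s(x, y) ∈ (discreteDomainGraph D.carrier δ).edgeSet ∧ s(x, y) ∈ ω := by
  filter_upwards [UpperCollarGeom.eventually_discreteDomainGraph_le hg] with δ hδ ω x y hxy
  refine ⟨?_, ?_⟩
  · rw [SimpleGraph.mem_edgeSet]
    exact hδ.2 hxy.2
  · exact ((Percolation.openGraph_adj ω x y).1 hxy.1).1

/-! ### The perturbed polygon of a family member lies in the domain -/

section PertTrace

variable {Dm : DobrushinDomain} {δ : ℝ} {ω : BondConfig (Site 2)} {a : MedialVertex}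
  {l : List MedialVertex}

/-- Inner faces depend only on the domain and the mesh. [folklore] -/
theorem isInnerFace_iff_of_eq {D D' : DiscreteDobrushin} (hΩ : D.Ω = D'.Ω) (hδ : D.δ = D'.δ)
    (f : Site 2) : D.IsInnerFace f ↔ D'.IsInnerFace f := by
  unfold DiscreteDobrushin.IsInnerFace
  rw [hΩ, hδ]

/-- **The perturbed polygon of the exploration of ANY Dobrushin data on `(Dm.carrier, δ)` lies in
the domain** (transfer of `pertTrace_subset_carrier` from `dobrushinData Dm δ` to data with the
same domain and mesh but arbitrary arcs, e.g. a member `Λ δ` of a `ZdDiscretisationFamily`).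
[cite: Smirnov2001, §2] -/
theorem pertTrace_subset_carrier_of_eq {D : DiscreteDobrushin} (hΩ : D.Ω = Dm.carrier)
    (hδD : D.δ = δ) (hδ : 0 < δ) (hexp : IsMedialExploration D ω (a :: l)) :
    hexp.pertTrace ⊆ Dm.carrier := by
  have hface : ∀ {f : Site 2}, D.IsInnerFace f → (Literature.Probability.Percolation.dobrushinData Dm δ).IsInnerFace f := fun hf =>
    (isInnerFace_iff_of_eq (D := D) (D' := Literature.Probability.Percolation.dobrushinData Dm δ) (by simpa using hΩ)
      (by simpa using hδD) _).1 hf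
  intro z hz
  have hδ' : 0 < D.δ := by rw [hδD]; exact hδ
  rcases hexp.mem_pertTrace_iff.1 hz with ⟨i, hi, hzi⟩ | ⟨i, ⟨hi1, hi⟩, hzi⟩
  · rw [hexp.dartPiece_eq, Set.mem_smul_set_iff_inv_smul_mem₀ hδ'.ne', hδD] at hzi
    exact mem_carrier_of_mem_openSq hδ (hface (hexp.isInnerFace hi))
      (dartSeg_subset_openSq (hexp.isCorner hi) hzi)
  · rcases hexp.connPiece_cases hi1 hi hδ' hzi with
      ⟨I, J, hJI, -, -, hcol, hside, -, hshape⟩ | ⟨I, J, hJI, -, -, -, -, hshape, -, -⟩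
    · rw [hδD] at hshape
      rcases hside with ⟨h1, h2⟩ | ⟨h1, h2⟩
      · exact mem_carrier_of_vConnShape hδ (hface (hexp.isInnerFace (by omega)))
          (hface (hexp.isInnerFace hi)) hJI rfl hcol.symm h1 h2 hshape
      · exact mem_carrier_of_vConnShape hδ (hface (hexp.isInnerFace hi))
          (hface (hexp.isInnerFace (by omega))) hJI hcol.symm rfl h2 h1 hshape
    · refine mem_carrier_of_mem_openSq hδ (hface (hexp.isInnerFace hi)) fun k => ?_
      obtain ⟨-, ⟨h1, h2⟩, h3⟩ := hshape
      rw [hδD] at h1 h2 h3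
      rcases fin_two_cases_of_ne hJI k with rfl | rfl
      · constructor <;> linarith
      · rcases h3 with h | h <;> rw [h] <;> constructor <;> linarith

/-- The perturbed polygon misses the boundary curve (general data). [cite: Smirnov2001, §2] -/
theorem pertTrace_disjoint_frontier_of_eq {D : DiscreteDobrushin} (hΩ : D.Ω = Dm.carrier)
    (hδD : D.δ = δ) (hδ : 0 < δ) (hexp : IsMedialExploration D ω (a :: l)) :
    Disjoint hexp.pertTrace (frontier Dm.carrier) :=
  Set.disjoint_left.2 fun _ hz hz' =>
    Set.disjoint_left.1 Dm.disjoint_carrier_frontier (pertTrace_subset_carrier_of_eq hΩ hδD hδ hexp hz) hz'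

end PertTrace

/-! ### Dual-wired sites inside `closure Ω` are close to the touch set -/

/-- **Dual-wired sites inside `closure Ω` are close to the touch set, eventually** (helper of
`stub_upperFence`).  Under `UpperCollarGeom R D G`, for a discretisation family `Λ` of `D` and
`η > 0`, for all small meshes `δ` every site of the dual-wired arc `zdArcB (Λ δ)` whose mesh point
lies in `closure Ω` is within `η / 2` of `G`. -/
theorem upperFence_dual_near_touch :
    ∀ (R : ConformalRectangle) (D : DobrushinDomain) (G : Set ℂ), UpperCollarGeom R D G →
      ∀ (Λ : ℝ → DiscreteDobrushin), ZdDiscretisationFamily D Λ → ∀ η : ℝ, 0 < η →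
        ∀ᶠ δ : ℝ in 𝓝[>] 0, ∀ x ∈ (Λ δ).zdArcB, meshPoint δ x ∈ closure R.carrier →
          infDist (meshPoint δ x) G ≤ η / 2 := by
  intro R D G hgeom Λ hΛ η hη
  -- the far part of the dual-wired arc is a compact set missing `closure Ω`
  set K : Set ℂ := D.arc 1 ∩ {g | η / 4 ≤ infDist g G} with hK
  have hKc : IsCompact K :=
    (D.isCompact_arc 1).inter_right (isClosed_le continuous_const (continuous_infDist_pt G))
  have hKd : Disjoint K (closure R.carrier) := by
    refine Set.disjoint_left.2 fun g hg hgΩ => ?_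
    have hgG : g ∈ G := hgeom.arc_one_inter_closure_subset ⟨hg.1, hgΩ⟩
    have : η / 4 ≤ infDist g G := hg.2
    rw [infDist_zero_of_mem hgG] at this
    linarith
  obtain ⟨ρ₀, hρ₀, hfar⟩ :=
    exists_pos_forall_lt_infDist hKc isClosed_closure hKd (R.nonempty.mono subset_closure)
  set τ := min (ρ₀ / 2) (η / 8) with hτ
  have hτpos : 0 < τ := by positivity
  have hτρ : τ ≤ ρ₀ / 2 := min_le_left _ _
  have hτη : τ ≤ η / 8 := min_le_right _ _
  have e3 : ∀ᶠ δ : ℝ in 𝓝[>] 0, hausdorffEDist (Λ δ).arcB (D.arc 1) < ENNReal.ofReal τ :=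
    hΛ.tendsto_arcB (Iio_mem_nhds (ENNReal.ofReal_pos.2 hτpos))
  filter_upwards [eventually_mesh_pos, eventually_mesh_lt (by positivity : 0 < τ / 3), e3] with δ
    hδ hδτ hH x hxB hxΩ
  have hΩ := hΛ.Ω_eq δ
  have hδE := hΛ.δ_eq δ
  obtain ⟨hxbd, hxle⟩ := ((Λ δ).mem_zdDiscreteArc_iff).1 hxB
  rw [hδE] at hxle
  obtain ⟨p, hp, hpx⟩ := exists_mem_frontier_dist_le_of_mem_zdBoundary (E := Λ δ)
    (by rw [hΩ]; exact D.isOpen) (by rw [hδE]; exact hδ.le) hxbd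
  rw [hδE] at hpx
  -- `2δ`-close to the arc datum, whatever it is
  have hA : infDist (meshPoint δ x) (Λ δ).arcB ≤ 2 * δ := by
    by_cases hpB : p ∈ (Λ δ).arcB
    · exact (infDist_le_dist_of_mem hpB).trans hpx
    · exact hxle.trans ((infDist_le_dist_of_mem
        (show p ∈ frontier (Λ δ).Ω \ (Λ δ).arcB from ⟨hp, hpB⟩)).trans hpx)
  -- `o(1)`-close to the dual-wired arc of `D`
  have h0 : infDist (meshPoint δ x) (D.arc 1) < 2 * δ + τ :=
    (infDist_le_infDist_add_hausdorffDist hH.ne_top).trans_lt (by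
      have hHD : hausdorffDist (Λ δ).arcB (D.arc 1) < τ := ENNReal.toReal_lt_of_lt_ofReal hH
      linarith)
  obtain ⟨g, hg, hgx⟩ := (infDist_lt_iff (⟨_, D.pt_mem_arc_self 1⟩ : (D.arc 1).Nonempty)).1 h0
  -- that point of the dual arc is near `closure Ω`, hence near `G`
  have hgΩ : infDist g (closure R.carrier) < ρ₀ :=
    (infDist_le_dist_of_mem hxΩ).trans_lt (by rw [dist_comm]; linarith)
  have hgG : infDist g G < η / 4 := by
    by_contra hcon
    exact lt_asymm hgΩ (hfar g ⟨hg, not_lt.1 hcon⟩)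
  have := infDist_le_infDist_add_dist (x := meshPoint δ x) (y := g) (s := G)
  linarith

/-- The same for sites whose mesh point lies in `Ω` itself (the form met by the fence argument:
the `B`-endpoint of the crossed edge is a vertex of the crossing path, a mesh vertex of `Ω`). -/
theorem upperFence_dual_near_touch' {R : ConformalRectangle} {D : DobrushinDomain} {G : Set ℂ}
    (hgeom : UpperCollarGeom R D G) {Λ : ℝ → DiscreteDobrushin} (hΛ : ZdDiscretisationFamily D Λ)
    {η : ℝ} (hη : 0 < η) :
    ∀ᶠ δ : ℝ in 𝓝[>] 0, ∀ x ∈ (Λ δ).zdArcB, meshPoint δ x ∈ R.carrier →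
      infDist (meshPoint δ x) G ≤ η / 2 := by
  filter_upwards [upperFence_dual_near_touch R D G hgeom Λ hΛ η hη] with δ h x hx hxΩ
  exact h x hx (subset_closure hxΩ)

/-! ### Connector exclusion and first exits -/

/-- **Connector exclusion, deterministic kernel.**  `Ω ⊆ D` open sets, `A` a set ("the arc read by
the crossing event") such that frontier points of `Ω` within `r` of `A` are frontier points of
`D`, and points of `closure D` outside `closure Ω` are `≥ s` away from `A`; mesh `0 < δ` with
`2δ < r`, `2δ < s`.  Then a lattice edge `{x, y}` at a site `x` of the discrete arc of `A` which is
not an edge of `Ω_δ` is not an edge of `D_δ` either. [folklore] -/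
theorem connector_not_adj_of_far {Ω D A : Set ℂ} (hΩ : IsOpen Ω) (hD : IsOpen D)
    {r s δ : ℝ} (hδ : 0 < δ) (hδr : 2 * δ < r) (hδs : 2 * δ < s)
    (hnear : ∀ z ∈ frontier Ω, infDist z A < r → z ∈ frontier D)
    (hfar : ∀ z ∈ closure D, z ∉ closure Ω → s ≤ infDist z A)
    {x y : Site 2} (hx : x ∈ discreteArc Ω δ A) (hxy : (zdGraph 2).Adj x y)
    (hnadj : ¬ (discreteDomainGraph Ω δ).Adj x y) :
    ¬ (discreteDomainGraph D δ).Adj x y := by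
  intro hD'
  obtain ⟨hmesh, -, hyD⟩ := discreteDomainGraph_adj_iff.1 hD'
  obtain ⟨-, hsegD⟩ := meshGraph_adj_iff.1 hmesh
  have hyDm : meshPoint δ y ∈ D := meshDomain_subset_meshVertices D δ hyD
  obtain ⟨hxB, hxle⟩ := mem_discreteArc_iff.1 hx
  have hdxy : dist (meshPoint δ x) (meshPoint δ y) = δ := by
    rw [dist_meshPoint_of_adj hxy, abs_of_pos hδ]
  -- `infDist (δx) A ≤ δ`
  have hxA : infDist (meshPoint δ x) A ≤ δ := by
    obtain ⟨y', hxy', w, hw, hwfr⟩ := exists_mem_frontier_of_mem_meshBoundary hΩ hxB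
    have hdw : dist (meshPoint δ x) w ≤ δ := by
      have h1 : w ∈ closedBall (meshPoint δ x) δ :=
        (convex_closedBall _ _).segment_subset (mem_closedBall_self hδ.le)
          (by rw [mem_closedBall, dist_comm, dist_meshPoint_of_adj hxy', abs_of_pos hδ]) hw
      rw [mem_closedBall, dist_comm] at h1
      exact h1
    by_cases hwA : w ∈ A
    · exact (infDist_le_dist_of_mem hwA).trans hdw
    · have hw' : w ∈ frontier Ω \ A := ⟨hwfr, hwA⟩
      exact hxle.trans ((infDist_le_dist_of_mem hw').trans hdw)
  by_cases hycl : meshPoint δ y ∈ closure Ω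
  · by_cases hyΩ : meshPoint δ y ∈ Ω
    · by_cases hseg : segment ℝ (meshPoint δ x) (meshPoint δ y) ⊆ closure Ω
      · -- same mesh component: `{x, y}` would be an `Ω_δ`-edge
        have hadj : (meshGraph Ω δ).Adj x y := meshGraph_adj_iff.2 ⟨hxy, hseg⟩
        exact hnadj (discreteDomainGraph_adj_iff.2
          ⟨hadj, hxB.1, mem_meshDomain_of_meshGraph_adj hxB.1 hyΩ hadj⟩)
      · -- the edge leaves `closure Ω` inside `closure D`
        rw [Set.not_subset] at hseg
        obtain ⟨p, hp, hpcl⟩ := hseg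
        have hps : s ≤ infDist p A := hfar p (hsegD hp) hpcl
        have hdp : dist p (meshPoint δ x) ≤ δ := by
          have : p ∈ closedBall (meshPoint δ x) δ :=
            (convex_closedBall _ _).segment_subset (mem_closedBall_self hδ.le)
              (by rw [mem_closedBall, dist_comm, hdxy]) hp
          exact mem_closedBall.1 this
        have := infDist_le_infDist_add_dist (x := p) (y := meshPoint δ x) (s := A)
        linarith
    · -- `δy ∈ ∂Ω` near `A`, hence on `∂D`, not in the open `D`
      have hyfr : meshPoint δ y ∈ frontier Ω := by
        rw [frontier_eq_closure_inter_closure]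
        exact ⟨hycl, subset_closure hyΩ⟩
      have hyA : infDist (meshPoint δ y) A < r := by
        have := infDist_le_infDist_add_dist (x := meshPoint δ y) (y := meshPoint δ x) (s := A)
        rw [dist_comm] at this
        linarith
      have hmem : meshPoint δ y ∈ D ∩ frontier D := ⟨hyDm, hnear _ hyfr hyA⟩
      rw [hD.inter_frontier_eq] at hmem
      exact hmem
  · -- `δy ∉ closure Ω`: a point of `closure D` outside `closure Ω` within `2δ` of `A`
    have hys : s ≤ infDist (meshPoint δ y) A := hfar _ (subset_closure hyDm) hycl
    have := infDist_le_infDist_add_dist (x := meshPoint δ y) (y := meshPoint δ x) (s := A)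
    rw [dist_comm] at this
    linarith

/-- **Connector exclusion under `UpperCollarGeom`, eventually in the mesh**, at both ends of the
crossing (`k = 0`: the arc `(ab)`, wired side; `k = 2`: the arc `(cd)`, dual side). [folklore] -/
theorem UpperCollarGeom.eventually_connector_not_adj {R : ConformalRectangle} {D : DobrushinDomain}
    {G : Set ℂ} (hg : UpperCollarGeom R D G) :
    ∀ᶠ δ : ℝ in 𝓝[>] 0, ∀ k : Fin 4, (k = 0 ∨ k = 2) →
      ∀ x ∈ discreteArc R.carrier δ (R.arc k), ∀ y : Site 2, (zdGraph 2).Adj x y →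
        ¬ (discreteDomainGraph R.carrier δ).Adj x y → ¬ (discreteDomainGraph D.carrier δ).Adj x y := by
  obtain ⟨r₀, hr₀, h₀⟩ := hg.near_arc_zero
  obtain ⟨r₂, hr₂, h₂⟩ := hg.near_arc_two
  obtain ⟨s, hs, hfar⟩ := hg.closure_far
  have hm : 0 < min (min r₀ r₂) s / 2 := by positivity
  filter_upwards [Ioo_mem_nhdsGT hm] with δ hδ k hk x hx y hxy hnadj
  have hδ0 : 0 < δ := hδ.1
  have h1 : min (min r₀ r₂) s ≤ r₀ := (min_le_left _ _).trans (min_le_left _ _)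
  have h2 : min (min r₀ r₂) s ≤ r₂ := (min_le_left _ _).trans (min_le_right _ _)
  have h3 : min (min r₀ r₂) s ≤ s := min_le_right _ _
  have hδ' := hδ.2
  rcases hk with rfl | rfl
  · exact connector_not_adj_of_far R.isOpen D.isOpen hδ0 (by linarith) (by linarith)
      (fun z hz hzA => D.arc_subset_frontier 0 (h₀ z hz hzA))
      (fun z hz hzΩ => (hfar z hz hzΩ).1) hx hxy hnadj
  · exact connector_not_adj_of_far R.isOpen D.isOpen hδ0 (by linarith) (by linarith)
      (fun z hz hzA => D.arc_subset_frontier 1 (h₂ z hz hzA))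
      (fun z hz hzΩ => (hfar z hz hzΩ).2) hx hxy hnadj

/-- **First frontier exit KEEPING the non-adjacency** (the form the fence argument needs; cf. the
tree's `exists_frontier_exit_of_mem_meshBoundary`, which drops `hnadj`).  A discrete boundary site
`x ∈ ∂Ω_δ` has a lattice neighbour `y` that is NOT an `Ω_δ`-neighbour, and a first frontier point
`f` on `[δx, δy]`: the initial piece `[δx, f]` lies in `closure Ω` and its points other than `f`
lie in `Ω`. [folklore] -/
theorem exists_frontier_exit_not_adj {Ω : Set ℂ} (hΩ : IsOpen Ω) {δ : ℝ} {x : Site 2}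
    (hx : x ∈ meshBoundary Ω δ) :
    ∃ (y : Site 2) (f : ℂ), (zdGraph 2).Adj x y ∧ ¬ (discreteDomainGraph Ω δ).Adj x y ∧
      f ∈ frontier Ω ∧ f ∈ segment ℝ (meshPoint δ x) (meshPoint δ y) ∧
      segment ℝ (meshPoint δ x) f ⊆ closure Ω ∧
      (∀ z ∈ segment ℝ (meshPoint δ x) f, z ≠ f → z ∈ Ω) := by
  obtain ⟨hxD, y, hxy, hy⟩ := mem_meshBoundary_iff.1 hx
  have hxΩ : meshPoint δ x ∈ Ω := meshDomain_subset_meshVertices Ω δ hxD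
  -- the edge is not inside `Ω` (else it would be an `Ω_δ`-edge)
  have hseg : ¬ segment ℝ (meshPoint δ x) (meshPoint δ y) ⊆ Ω := by
    intro h
    have hadj : (meshGraph Ω δ).Adj x y := meshGraph_adj_iff.2 ⟨hxy, h.trans subset_closure⟩
    have hyΩ : meshPoint δ y ∈ Ω := h (right_mem_segment ℝ _ _)
    exact hy (discreteDomainGraph_adj_iff.2 ⟨hadj, hxD, mem_meshDomain_of_meshGraph_adj hxD hyΩ hadj⟩)
  obtain ⟨t, ht0, ht1, hfr, -, hbefore⟩ := exists_first_exit hΩ hxΩ hseg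
  set p := meshPoint δ x with hp
  set q := meshPoint δ y with hq
  refine ⟨y, p + t • (q - p), hxy, hy, hfr, ?_, ?_, ?_⟩
  · rw [segment_eq_image']
    exact ⟨t, ⟨ht0.le, ht1⟩, rfl⟩
  · intro z hz
    obtain ⟨θ, hθ, rfl⟩ := exists_param_of_mem_subsegment hz
    rcases hθ.2.eq_or_lt with rfl | hθ1
    · rw [one_mul]
      exact frontier_subset_closure hfr
    · exact subset_closure (hbefore _ (mul_nonneg hθ.1 ht0.le) (by nlinarith))
  · intro z hz hne
    obtain ⟨θ, hθ, rfl⟩ := exists_param_of_mem_subsegment hz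
    rcases hθ.2.eq_or_lt with rfl | hθ1
    · exact absurd (by rw [one_mul]) hne
    · exact hbefore _ (mul_nonneg hθ.1 ht0.le) (by nlinarith)

end Summit.CriticalPhenomena.CardyFormulaZ2.Cruxes.SLESixFamiliesGiveCardy.CollarTouchSandwich

end
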